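import Literature.Computability.AlgebraicComplexity.BorderRankExtensionSieveForced
import HarnessLib

/-!
# The extension sieve, III: slack one — quadratic conditions (vanishing `2 × 2` minors)

Topic `Literature/Computability/AlgebraicComplexity`; a trunk-independent TOOL continuing
`BorderRankExtension.lean` (lemma (E1): a tensor `t ∈ K^ι ⊗ K^κ ⊗ K^μ` with `|ι| < r`, `bR(t) ≤ r`
has a new slice `Z ∉ V = t((K^ι)^*)` with `bR(t + e_new ⊗ Z) ≤ r`), `BorderRankExtensionSieve.lean`
(source roles: a new slice adds new COLUMNS to a Koszul flattening) and
`BorderRankExtensionSieveForced.lean` (row roles: new ROWS).  There a role was TIGHT (old rank already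
`C(q-1,p)·r`), forcing LINEAR conditions on `Z`.  Here a role has SLACK ONE (old rank `C(q-1,p)·r - 1`),
and the conditions on `Z` are QUADRATIC — all PROVED over an arbitrary field:

* **Rank bookkeeping** (`rank_mul_add_rank_submatrix_le`): if `Y` kills the selected columns
  `M.submatrix id f` of `M`, then `rank (Y M) + rank (M.submatrix id f) ≤ rank M`; hence with old rank
  `≥ C(q-1,p)·r - 1` and `rank ≤ C(q-1,p)·bR ≤ C(q-1,p)·r` on the extension, the matrix
  `N = Y · (new block)(Z)` — rows = certified kernel vectors `y_α` of the old flattening, columns = the new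
  indices `S` — has rank `≤ 1`, so its `2 × 2` minors vanish (`minor_eq_zero_of_rank_le_one`):
  `L(α,S)(Z) · L(α',S')(Z) = L(α,S')(Z) · L(α',S)(Z)` where `L(α,S)` is exactly the linear form of the
  condition `(role, y_α, S)` of the linear sieve (`SieveCert.lamEntryR`) — `srcFlattening_minor`,
  `rowFlattening_minor`, `SieveCert.qminor_eq_zero`.
* **Certificate** (`SieveCert.checkQ` / `SieveCert.lt_algBorderRank_of_checkQ`): kernel vectors with
  their roles (each certified on codes, `condVanishR`), slack-one rank certificates (`3r - 1` unit-pivot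
  rows), the TABLE of the forms `L(α,s)` (verified entrywise against `lamEntryR`), a selection of minors,
  integer functionals `ℓ_1, …, ℓ_{bc-a}` killing the slices with `rank ≥ bc - a`, an integer `D` and
  integer combinations `D · ℓ_i² = ∑_m C_{i,m} · minor_m` — identities of quadratic forms checked
  COEFFICIENTWISE in the monomial basis `z_{k₁} z_{k₂}` (`k₁ ≤ k₂`).  Over any field with `D ≠ 0`:
  `ℓ_i(Z)² = 0 ⇒ ℓ_i(Z) = 0 ⇒ Z ∈ V` (dimension count, `rank(slices) = a`) — contradicting (E1); so
  `r < bR(T)`.  Transports `…_rotate₁/₂` extend along the second / third factor.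

This is the formal counterpart of the bundle's `extension-slack-minors` verdicts (rows `T4-632`, `T4-698`,
`T4-817`, `T4-818`, `T4-819` of the tight-`[4]^3` census, `bR = 6`), in the language of
Jagiełła–Jelisiejew unrestrictions (a border rank `≤ r` tensor with fewer than `r` slices is a restriction
of one with one more slice and border rank `≤ r`; the Koszul–Young flattening equations of
Landsberg–Ottaviani cut the possible new slices).

HONEST FRAMING (pub-tensor bundle): a THEOREM-level tool for CERTIFICATES about explicit small tensors,
NOT progress on the exponent of matrix multiplication.

## References

* J. Jagiełła, J. Jelisiejew, *Unrestrictions and concise secant varieties*, arXiv:2604.24879 (2026),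
  §1.4, Thm. 2.2, Lemma 2.7 [JagiellaJelisiejew2026Unrestrictions].
* J. M. Landsberg, G. Ottaviani, *New lower bounds for the border rank of matrix multiplication*,
  Theory of Computing 11 (2015), Thm. 2.1 [LandsbergOttaviani2015].
* J. M. Landsberg, *Geometry and complexity theory*, CUP 2017, §2.4.2 [LandsbergGCT2017].
* M. Bläser, *Fast Matrix Multiplication*, Theory of Computing Graduate Surveys 5 (2013), §5.1
  [Blaser2013].
-/

open scoped BigOperators Matrix
open Matrix

namespace Literature.Computability.AlgebraicComplexity

open Literature.LinearAlgebra.Matrix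

universe u

/-! ## A. Rank bookkeeping and `2 × 2` minors -/

section LinAlg

variable {K : Type*} [Field K]

/-- **Rank bookkeeping for an extension by columns.** If `Y` kills the selected columns
`M.submatrix id f`, then `rank (Y * M) + rank (M.submatrix id f) ≤ rank M`: the column space `W₀` of the
selected columns lies in `W = col(M)` and in `ker Y`, and `Y(W) = col(Y M)`. [folklore] -/
theorem rank_mul_add_rank_submatrix_le {k m n n₀ : Type*} [Fintype k] [Fintype m] [Fintype n]
    [Fintype n₀] (Y : Matrix k m K) (M : Matrix m n K) (f : n₀ → n)
    (hY : Y * M.submatrix id f = 0) : (Y * M).rank + (M.submatrix id f).rank ≤ M.rank := by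
  classical
  set W : Submodule K (m → K) := LinearMap.range M.mulVecLin with hW
  set W₀ : Submodule K (m → K) := LinearMap.range (M.submatrix id f).mulVecLin with hW₀
  have hW₀W : W₀ ≤ W := by
    rw [hW₀, hW, Matrix.range_mulVecLin, Matrix.range_mulVecLin]
    refine Submodule.span_mono ?_
    rintro _ ⟨j, rfl⟩
    exact ⟨f j, rfl⟩
  have hW₀ker : W₀ ≤ LinearMap.ker Y.mulVecLin := by
    rintro _ ⟨x, rfl⟩
    rw [LinearMap.mem_ker, Matrix.mulVecLin_apply, Matrix.mulVecLin_apply, Matrix.mulVec_mulVec, hY,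
      Matrix.zero_mulVec]
  set φ : W →ₗ[K] (k → K) := Y.mulVecLin.domRestrict W with hφ
  have hrange : LinearMap.range φ = LinearMap.range (Y * M).mulVecLin := by
    rw [hφ, LinearMap.range_domRestrict, hW, Matrix.mulVecLin_mul, LinearMap.range_comp]
  have hker : Module.finrank K W₀ ≤ Module.finrank K (LinearMap.ker φ) := by
    have e := Submodule.comapSubtypeEquivOfLe hW₀W
    rw [← e.finrank_eq]
    refine Submodule.finrank_mono ?_
    rw [hφ, LinearMap.ker_domRestrict]
    exact Submodule.comap_mono hW₀ker
  have hrn := LinearMap.finrank_range_add_finrank_ker φ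
  unfold Matrix.rank
  rw [← hrange]
  change Module.finrank K (LinearMap.range φ) + Module.finrank K W₀ ≤ Module.finrank K W
  omega

/-- The same for an extension by ROWS: if the selected rows `M.submatrix f id` kill `X`, then
`rank (M * X) + rank (M.submatrix f id) ≤ rank M`. [folklore] -/
theorem rank_mul_add_rank_submatrix_le' {k m n m₀ : Type*} [Fintype k] [Fintype m] [Fintype n]
    [Fintype m₀] (M : Matrix m n K) (X : Matrix n k K) (f : m₀ → m)
    (hX : M.submatrix f id * X = 0) : (M * X).rank + (M.submatrix f id).rank ≤ M.rank := by
  classical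
  have h1 : Xᵀ * Mᵀ.submatrix id f = 0 := by
    rw [← Matrix.transpose_submatrix, ← Matrix.transpose_mul, hX, Matrix.transpose_zero]
  have key := rank_mul_add_rank_submatrix_le Xᵀ Mᵀ f h1
  rw [← Matrix.transpose_mul, Matrix.rank_transpose, ← Matrix.transpose_submatrix,
    Matrix.rank_transpose, Matrix.rank_transpose] at key
  exact key

/-- A matrix of rank `≤ 1` has vanishing `2 × 2` minors. [folklore] -/
theorem minor_eq_zero_of_rank_le_one {k n : Type*} [Fintype k] [Fintype n] (N : Matrix k n K)
    (hN : N.rank ≤ 1) (α α' : k) (s s' : n) : N α s * N α' s' - N α s' * N α' s = 0 := by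
  classical
  set D : Matrix (Fin 2) (Fin 2) K := N.submatrix ![α, α'] ![s, s'] with hD
  have hDr : D.rank ≤ 1 := (Matrix.rank_submatrix_le N _ _).trans hN
  have hdet : D.det = 0 := by
    by_contra h
    have hu : IsUnit D := (Matrix.isUnit_iff_isUnit_det D).2 (isUnit_iff_ne_zero.2 h)
    have h2 := Matrix.rank_of_isUnit D hu
    rw [Fintype.card_fin] at h2
    omega
  rw [Matrix.det_fin_two] at hdet
  simpa [hD] using hdet

end LinAlg

/-! ## B. Slack one: the `2 × 2` minors of the new block vanish -/

section Roles

variable {K : Type u} [Field K] {ι κ μ : Type} [Fintype κ] [Fintype ι] [Fintype μ] [DecidableEq ι]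
  [DecidableEq κ] [DecidableEq μ]

/-- **The quadratic condition of a slack-one SOURCE role.** If `bR(extendSlice t Z) ≤ r`, the old
matrix has rank `≥ C(q-1,p)·r - 1`, and `y, y'` are left-kernel vectors of the old matrix, then with
`f(y, S) = ∑_{(T,c)} y(T,c) · ∑_j (∑_x ε(T,S,x) M_{xj}) · Z_{jc}` (the value of `y` on the new column
`(S, new)`): `f(y,S) f(y',S') = f(y,S') f(y',S)`. [cite: LandsbergOttaviani2015, Thm 2.1] [cite: JagiellaJelisiejew2026Unrestrictions, Thm. 2.2 (use of the extension)] -/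
theorem srcFlattening_minor (q p : ℕ) (M : Matrix (Fin q) κ K) (t : ι → κ → μ → K)
    (Z : κ → μ → K) {r : ℕ} (hZ : algBorderRank (extendSlice t Z) ≤ r)
    (hcap : (q - 1).choose p * r ≤ (srcFlattening q p M t).rank + 1)
    (y y' : PSub q (p + 1) × μ → K) (hy : y ᵥ* srcFlattening q p M t = 0)
    (hy' : y' ᵥ* srcFlattening q p M t = 0) (S S' : PSub q p) :
    (∑ rr : PSub q (p + 1) × μ, y rr * ∑ j, (∑ x, (wedgeInc rr.1.1 S.1 x : K) * M x j) * Z j rr.2) *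
        (∑ rr : PSub q (p + 1) × μ, y' rr *
          ∑ j, (∑ x, (wedgeInc rr.1.1 S'.1 x : K) * M x j) * Z j rr.2) -
      (∑ rr : PSub q (p + 1) × μ, y rr * ∑ j, (∑ x, (wedgeInc rr.1.1 S'.1 x : K) * M x j) * Z j rr.2) *
        (∑ rr : PSub q (p + 1) × μ, y' rr *
          ∑ j, (∑ x, (wedgeInc rr.1.1 S.1 x : K) * M x j) * Z j rr.2) = 0 := by
  classical
  set F := srcFlattening q p M (extendSlice t Z) with hF
  set Y : Matrix (Fin 2) (PSub q (p + 1) × μ) K := Matrix.of ![y, y'] with hYdef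
  have hrank : F.rank ≤ (q - 1).choose p * r :=
    (rank_srcFlattening_le q p M (extendSlice t Z)).trans (Nat.mul_le_mul_left _ hZ)
  have hold : F.submatrix id (fun x : PSub q p × ι => (x.1, some x.2)) = srcFlattening q p M t := by
    rw [hF, srcFlattening_extendSlice_submatrix]
  have hY : Y * F.submatrix id (fun x : PSub q p × ι => (x.1, some x.2)) = 0 := by
    rw [hold]
    ext i x
    fin_cases i
    · simpa [hYdef, Matrix.mul_apply, Matrix.vecMul, dotProduct] using congr_fun hy x
    · simpa [hYdef, Matrix.mul_apply, Matrix.vecMul, dotProduct] using congr_fun hy' x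
  have hb := rank_mul_add_rank_submatrix_le Y F _ hY
  rw [hold] at hb
  have hN : (Y * F).rank ≤ 1 := by omega
  have key := minor_eq_zero_of_rank_le_one (Y * F) hN 0 1 (S, none) (S', none)
  simp only [Matrix.mul_apply, hYdef, Matrix.of_apply, Matrix.cons_val_zero, Matrix.cons_val_one,
    hF, srcFlattening_extendSlice_none] at key
  exact key

/-- **The quadratic condition of a slack-one ROW role.** If `bR(extendSlice t Z) ≤ r`, the old rows
have rank `≥ C(q-1,p)·r - 1`, and `x, x'` are right-kernel vectors of the old rows, then with
`g(x, T) = ∑_{(S,m)} x(S,m) · ∑_k (∑_x' ε(T,S,x') M_{x'k}) · Z_{km}` (the value of the new row `(T, new)`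
on `x`): `g(x,T) g(x',T') = g(x,T') g(x',T)`. [cite: LandsbergOttaviani2015, Thm 2.1] [cite: JagiellaJelisiejew2026Unrestrictions, Thm. 2.2 (use of the extension)] -/
theorem rowFlattening_minor (q p : ℕ) (M : Matrix (Fin q) κ K) (t : ι → κ → μ → K)
    (Z : κ → μ → K) {r : ℕ} (hZ : algBorderRank (extendSlice t Z) ≤ r)
    (hcap : (q - 1).choose p * r ≤ (rowFlattening q p M t).rank + 1) (x x' : PSub q p × μ → K)
    (hx : rowFlattening q p M t *ᵥ x = 0) (hx' : rowFlattening q p M t *ᵥ x' = 0)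
    (T T' : PSub q (p + 1)) :
    (∑ cc : PSub q p × μ, x cc * ∑ k, (∑ x'', (wedgeInc T.1 cc.1.1 x'' : K) * M x'' k) * Z k cc.2) *
        (∑ cc : PSub q p × μ, x' cc *
          ∑ k, (∑ x'', (wedgeInc T'.1 cc.1.1 x'' : K) * M x'' k) * Z k cc.2) -
      (∑ cc : PSub q p × μ, x cc * ∑ k, (∑ x'', (wedgeInc T'.1 cc.1.1 x'' : K) * M x'' k) * Z k cc.2) *
        (∑ cc : PSub q p × μ, x' cc *
          ∑ k, (∑ x'', (wedgeInc T.1 cc.1.1 x'' : K) * M x'' k) * Z k cc.2) = 0 := by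
  classical
  set F := rowFlattening q p M (extendSlice t Z) with hF
  set X : Matrix (PSub q p × μ) (Fin 2) K := (Matrix.of ![x, x'])ᵀ with hXdef
  have hrank : F.rank ≤ (q - 1).choose p * r :=
    (rank_rowFlattening_le q p M (extendSlice t Z)).trans (Nat.mul_le_mul_left _ hZ)
  have hold : F.submatrix (fun x : PSub q (p + 1) × ι => (x.1, some x.2)) id =
      rowFlattening q p M t := by
    rw [hF, rowFlattening_extendSlice_submatrix]
  have hX : F.submatrix (fun x : PSub q (p + 1) × ι => (x.1, some x.2)) id * X = 0 := by
    rw [hold]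
    ext rr i
    fin_cases i
    · simpa [hXdef, Matrix.mul_apply, Matrix.mulVec, dotProduct] using congr_fun hx rr
    · simpa [hXdef, Matrix.mul_apply, Matrix.mulVec, dotProduct] using congr_fun hx' rr
  have hb := rank_mul_add_rank_submatrix_le' F X _ hX
  rw [hold] at hb
  have hN : (F * X).rank ≤ 1 := by omega
  have key := minor_eq_zero_of_rank_le_one (F * X) hN (T, none) (T', none) 0 1
  simp only [Matrix.mul_apply, hXdef, Matrix.transpose_apply, Matrix.of_apply, Matrix.cons_val_zero,
    Matrix.cons_val_one, hF, rowFlattening_extendSlice_none] at key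
  have e : ∀ (v : PSub q p × μ → K) (R : PSub q (p + 1)),
      (∑ cc : PSub q p × μ, v cc * ∑ k, (∑ x'', (wedgeInc R.1 cc.1.1 x'' : K) * M x'' k) * Z k cc.2) =
        ∑ cc : PSub q p × μ, (∑ k, (∑ x'', (wedgeInc R.1 cc.1.1 x'' : K) * M x'' k) * Z k cc.2) *
          v cc := fun v R => Finset.sum_congr rfl fun cc _ => mul_comm _ _
  rw [e x T, e x' T', e x T', e x' T]
  linear_combination key

end Roles

/-! ## C. Integer certificates on codes (`q = 4`, `p = 1`, extended factor first, slack-one roles) -/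

namespace SieveCert

open KYCert KYGen

/-- A kernel vector with its role: `(role, sparse vector on codes)`; roles as in `lamEntryR`
(`1`, `3`: LEFT-kernel vectors of the source-role flattenings with exterior map on the second / third
factor; `2`, `4`: RIGHT-kernel vectors of the row-role flattenings). [folklore] -/
abbrev KVec : Type := ℕ × List (ℕ × ℤ)

/-- A selected `2 × 2` minor `(α, α', s, s')`: kernel vectors `α, α'` of the same role, new indices
`s, s'` (singletons `< 4` for source roles, pairs `< 6` for row roles). [folklore] -/
abbrev QMinor : Type := ℕ × ℕ × ℕ × ℕ

/-- Kernel vector number `α` (default: the empty vector). [folklore] -/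
def kvGet (kv : List KVec) (α : ℕ) : KVec := kv.getD α (0, [])

/-- The condition `(ρ_α, v_α, s)` of kernel vector `α` and new index `s`. [folklore] -/
def qcond (kv : List KVec) (α s : ℕ) : Cond := ((kvGet kv α).1, (kvGet kv α).2, s)

/-- The TABLE of linear forms is correct: row `6α + s` of `ltab` is `λ_{(ρ_α, v_α, s)}` (`lamEntryR`) at
every code `k = j c + l < b c`. [folklore] -/
def ltabOk (b c : ℕ) (M1 M3 : List (List ℤ)) (kv : List KVec) (ltab : List (List ℤ)) : Bool :=
  (List.range kv.length).all fun α => (List.range 6).all fun s => (List.range (b * c)).all fun k =>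
    mget ltab (α * 6 + s) k == lamEntryR b c M1 M3 (qcond kv α s) (k / c) (k % c)

/-- Coefficient of `z_{k₁} z_{k₂}` (`k₁ ≤ k₂`) in the product of the linear forms with integer rows
`u`, `v`. [folklore] -/
def prodCoef (u v : ℕ → ℤ) (k1 k2 : ℕ) : ℤ :=
  if k1 = k2 then u k1 * v k1 else u k1 * v k2 + u k2 * v k1

/-- Coefficient of `z_{k₁} z_{k₂}` (`k₁ ≤ k₂`) in the minor `L(α,s) L(α',s') - L(α,s') L(α',s)`.
[folklore] -/
def minorCoef (ltab : List (List ℤ)) (m : QMinor) (k1 k2 : ℕ) : ℤ :=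
  prodCoef (mget ltab (m.1 * 6 + m.2.2.1)) (mget ltab (m.2.1 * 6 + m.2.2.2)) k1 k2 -
    prodCoef (mget ltab (m.1 * 6 + m.2.2.2)) (mget ltab (m.2.1 * 6 + m.2.2.1)) k1 k2

/-- The selected minors are well formed: indices in range, both kernel vectors of the same role.
[folklore] -/
def qselOk (kv : List KVec) (qsel : List QMinor) : Bool :=
  qsel.all fun m => decide (m.1 < kv.length) && decide (m.2.1 < kv.length) && decide (m.2.2.1 < 6) &&
    decide (m.2.2.2 < 6) && ((kvGet kv m.1).1 == (kvGet kv m.2.1).1)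

/-- The SQUARE certificates: for every row `i < b c` of the functional table `Lfun` and every
`k₁ ≤ k₂ < b c`, `D · coef_{k₁k₂}(ℓ_i²) = ∑_{(m,C) ∈ sq_i} C · coef_{k₁k₂}(minor_m)` (all `m` in range).
[folklore] -/
def sqOk (b c : ℕ) (ltab : List (List ℤ)) (qsel : List QMinor) (Lfun : List (List ℤ)) (D : ℤ)
    (sq : List (List (ℕ × ℤ))) : Bool :=
  (List.range (b * c)).all fun i =>
    ((sq.getD i []).all fun mc => decide (mc.1 < qsel.length)) &&
    (List.range (b * c)).all fun k1 => (List.range (b * c)).all fun k2 => !(decide (k1 ≤ k2)) ||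
      (D * prodCoef (mget Lfun i) (mget Lfun i) k1 k2 ==
        ((sq.getD i []).map fun mc => mc.2 * minorCoef ltab (qsel.getD mc.1 (0, 0, 0, 0)) k1 k2).sum)

/-- The functionals `ℓ_k` (rows of `Lfun`, column code `j c + l`) kill every slice, on codes.
[folklore] -/
def funKills (a b c : ℕ) [NeZero a] [NeZero b] [NeZero c] (T : Fin a → Fin b → Fin c → ℤ)
    (Lfun : List (List ℤ)) : Bool :=
  (List.range (b * c)).all fun k => (List.range a).all fun i =>
    lsum b (fun j => lsum c fun l =>
      mget Lfun k (j * c + l) * T (finCode a i) (finCode b j) (finCode c l)) == 0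

/-- The functional matrix on codes: row `k` (read mod `b c`), column code `q = j c + l`. [folklore] -/
def lfunCode (b c : ℕ) (Lfun : List (List ℤ)) (k q : ℕ) : ℤ :=
  mget Lfun (k % (b * c)) (q / c % b * c + q % c)

/-- The functional matrix with `b c` rows and columns `Fin b × Fin c`. [folklore] -/
def lfunMat (b c : ℕ) (Lfun : List (List ℤ)) : Matrix (Fin (b * c)) (Fin b × Fin c) ℤ :=
  Matrix.of fun k p => mget Lfun k (p.1 * c + p.2)

/-- Rank certificates (`cap` unit-pivot rows; `cap = 3r - 1` = slack one) of the old flattenings of the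
roles in use. [cite: LandsbergOttaviani2015, Thm 2.1] -/
def capsQ (a b c cap : ℕ) [NeZero a] [NeZero b] [NeZero c] (T : Fin a → Fin b → Fin c → ℤ)
    (M1 M3 : List (List ℤ)) (kv : List KVec) (rows1 : List (List (ℕ × ℤ))) (piv1 : List ℕ)
    (rows2 : List (List (ℕ × ℤ))) (piv2 : List ℕ) (rows3 : List (List (ℕ × ℤ))) (piv3 : List ℕ)
    (rows4 : List (List (ℕ × ℤ))) (piv4 : List ℕ) : Bool :=
  (!(kv.any fun rv => rv.1 == 1) ||
    intTriCheckUnit cap (kyEntry4 b a c M1 (fun j i l => T i j l)) rows1 piv1) &&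
  (!(kv.any fun rv => rv.1 == 2) ||
    intTriCheckUnit cap (kyEntry4 b c a M1 (fun j l i => T i j l)) rows2 piv2) &&
  (!(kv.any fun rv => !(rv.1 == 1) && !(rv.1 == 2) && !(rv.1 == 4)) ||
    intTriCheckUnit cap (kyEntry4 c a b M3 (fun l i j => T i j l)) rows3 piv3) &&
  (!(kv.any fun rv => rv.1 == 4) ||
    intTriCheckUnit cap (kyEntry4 c b a M3 (fun l j i => T i j l)) rows4 piv4)

/-- **The quadratic (slack-one) sieve certificate** for `r < bR(T)` (given `a < r ≤ bR(T)` and `D ≠ 0`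
in `K`): kernel vectors certified on codes; slack-one caps (`3r - 1`); the table of forms; well-formed
minors; the functionals kill the slices; `rank(functionals) ≥ bc - a`, `rank(slices) ≥ a` (unit-pivot
row certificates); the square certificates. [cite: JagiellaJelisiejew2026Unrestrictions, Thm. 2.2] [cite: LandsbergOttaviani2015, Thm 2.1] -/
def checkQ (a b c r : ℕ) [NeZero a] [NeZero b] [NeZero c] (T : Fin a → Fin b → Fin c → ℤ)
    (M1 M3 : List (List ℤ)) (kv : List KVec) (ltab : List (List ℤ)) (qsel : List QMinor)
    (Lfun : List (List ℤ)) (D : ℤ) (sq : List (List (ℕ × ℤ))) (rows1 : List (List (ℕ × ℤ)))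
    (piv1 : List ℕ) (rows2 : List (List (ℕ × ℤ))) (piv2 : List ℕ) (rows3 : List (List (ℕ × ℤ)))
    (piv3 : List ℕ) (rows4 : List (List (ℕ × ℤ))) (piv4 : List ℕ) (rowsL : List (List (ℕ × ℤ)))
    (pivL : List ℕ) (rowsS : List (List (ℕ × ℤ))) (pivS : List ℕ) : Bool :=
  (kv.all fun rv => condVanishR a b c T M1 M3 (rv.1, rv.2, 0)) &&
  capsQ a b c (3 * r - 1) T M1 M3 kv rows1 piv1 rows2 piv2 rows3 piv3 rows4 piv4 &&
  ltabOk b c M1 M3 kv ltab &&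
  qselOk kv qsel &&
  funKills a b c T Lfun &&
  intTriCheckUnit (b * c - a) (lfunCode b c Lfun) rowsL pivL &&
  intTriCheckUnit a (slabCode a b c T) rowsS pivS &&
  sqOk b c ltab qsel Lfun D sq

section Sound

variable {K : Type u} [Field K]

/-! ### C.1 The minors of one slack-one role vanish -/

/-- **The quadratic condition on codes**: for two certified kernel vectors `v, v'` of the same role `ρ`
whose old flattening has rank `≥ 3r - 1`, and an admissible `Z` (`bR(extendSlice T Z) ≤ r`):
`L(ρ,v,s)(Z) · L(ρ,v',s')(Z) = L(ρ,v,s')(Z) · L(ρ,v',s)(Z)`, `L = ∑_{j,l} lamEntryR(ρ,·,·)(j,l) Z_{jl}`.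
[cite: LandsbergOttaviani2015, Thm 2.1] [cite: JagiellaJelisiejew2026Unrestrictions, Thm. 2.2] -/
theorem qminor_eq_zero {a b c r : ℕ} [NeZero a] [NeZero b] [NeZero c]
    (T : Fin a → Fin b → Fin c → ℤ) {M1 M3 : List (List ℤ)} (ρ : ℕ) (v v' : List (ℕ × ℤ))
    (s s' : ℕ) {rows1 rows2 rows3 rows4 : List (List (ℕ × ℤ))} {piv1 piv2 piv3 piv4 : List ℕ}
    (hvan : condVanishR a b c T M1 M3 (ρ, v, 0) = true)
    (hvan' : condVanishR a b c T M1 M3 (ρ, v', 0) = true)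
    (hcap1 : ρ = 1 →
      intTriCheckUnit (3 * r - 1) (kyEntry4 b a c M1 (fun j i l => T i j l)) rows1 piv1 = true)
    (hcap2 : ρ = 2 →
      intTriCheckUnit (3 * r - 1) (kyEntry4 b c a M1 (fun j l i => T i j l)) rows2 piv2 = true)
    (hcap3 : ρ ≠ 1 → ρ ≠ 2 → ρ ≠ 4 →
      intTriCheckUnit (3 * r - 1) (kyEntry4 c a b M3 (fun l i j => T i j l)) rows3 piv3 = true)
    (hcap4 : ρ = 4 →
      intTriCheckUnit (3 * r - 1) (kyEntry4 c b a M3 (fun l j i => T i j l)) rows4 piv4 = true)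
    (Z : Fin b → Fin c → K) (hle : algBorderRank (extendSlice (fun i j l => (T i j l : K)) Z) ≤ r) :
    (∑ j : Fin b, ∑ l : Fin c, (lamEntryR b c M1 M3 (ρ, v, s) j l : K) * Z j l) *
        (∑ j : Fin b, ∑ l : Fin c, (lamEntryR b c M1 M3 (ρ, v', s') j l : K) * Z j l) -
      (∑ j : Fin b, ∑ l : Fin c, (lamEntryR b c M1 M3 (ρ, v, s') j l : K) * Z j l) *
        (∑ j : Fin b, ∑ l : Fin c, (lamEntryR b c M1 M3 (ρ, v', s) j l : K) * Z j l) = 0 := by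
  classical
  set tK : Fin a → Fin b → Fin c → K := fun i j l => (T i j l : K) with htK
  have hext : algBorderRank (extendSlice (fun i l j => tK i j l) fun l j => Z j l) ≤ r := by
    have e : (extendSlice (fun i l j => tK i j l) fun l j => Z j l) =
        fun x l j => extendSlice tK Z x j l := by
      funext x l j; cases x <;> rfl
    rw [e, algBorderRank_swap₂₃ (extendSlice tK Z)]
    exact hle
  have h3 : (4 - 1).choose 1 = 3 := by decide
  by_cases h2 : ρ = 2
  · subst h2
    unfold condVanishR at hvan hvan'
    simp only [if_true] at hvan hvan'
    have hcap := le_rank_rowFlattening (K := K) T M1 (hcap2 rfl)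
    have hcap' : 3 * r ≤
        (rowFlattening 4 1 ((mat4 b M1).map (Int.cast : ℤ → K)) fun i j l => (T i j l : K)).rank + 1 := by
      omega
    have hx := rowFlattening_mulVec_eq_zero (K := K) T M1 v hvan
    have hx' := rowFlattening_mulVec_eq_zero (K := K) T M1 v' hvan'
    have hform : ∀ (w : List (ℕ × ℤ)) (s₀ : ℕ),
        (∑ j : Fin b, ∑ l : Fin c, (lamEntryR b c M1 M3 (2, w, s₀) j l : K) * Z j l) =
          ∑ cc : PSub 4 1 × Fin c, intCertRow (F := K) (colDec4 c) w cc *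
            ∑ k, (∑ x, (wedgeInc (pairOf4 (finCode 6 s₀)).1 cc.1.1 x : K) *
              ((mat4 b M1).map (Int.cast : ℤ → K)) x k) * Z k cc.2 := by
      intro w s₀
      simp only [lamEntryR, if_true]
      rw [sum_lamRow_one]
    rw [hform v s, hform v' s', hform v s', hform v' s]
    exact rowFlattening_minor 4 1 ((mat4 b M1).map (Int.cast : ℤ → K)) tK Z hle
      (by rw [h3]; simpa using hcap') _ _ hx hx' _ _
  by_cases h4 : ρ = 4
  · subst h4
    unfold condVanishR at hvan hvan'
    simp only [show (4 : ℕ) ≠ 2 by decide, if_false, if_true] at hvan hvan'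
    have hcap := le_rank_rowFlattening (K := K) (fun i l j => T i j l) M3 (hcap4 rfl)
    have hcap' : 3 * r ≤ (rowFlattening 4 1 ((mat4 c M3).map (Int.cast : ℤ → K))
        fun i j l => (T i l j : K)).rank + 1 := by
      omega
    have hx := rowFlattening_mulVec_eq_zero (K := K) (fun i l j => T i j l) M3 v hvan
    have hx' := rowFlattening_mulVec_eq_zero (K := K) (fun i l j => T i j l) M3 v' hvan'
    have hform : ∀ (w : List (ℕ × ℤ)) (s₀ : ℕ),
        (∑ j : Fin b, ∑ l : Fin c, (lamEntryR b c M1 M3 (4, w, s₀) j l : K) * Z j l) =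
          ∑ cc : PSub 4 1 × Fin b, intCertRow (F := K) (colDec4 b) w cc *
            ∑ k, (∑ x, (wedgeInc (pairOf4 (finCode 6 s₀)).1 cc.1.1 x : K) *
              ((mat4 c M3).map (Int.cast : ℤ → K)) x k) * (fun l j => Z j l) k cc.2 := by
      intro w s₀
      simp only [lamEntryR, show (4 : ℕ) ≠ 2 by decide, if_false, if_true]
      rw [Finset.sum_comm, sum_lamRow_one]
    rw [hform v s, hform v' s', hform v s', hform v' s]
    exact rowFlattening_minor 4 1 ((mat4 c M3).map (Int.cast : ℤ → K)) (fun i l j => tK i j l)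
      (fun l j => Z j l) hext (by rw [h3]; simpa using hcap') _ _ hx hx' _ _
  -- the source roles
  unfold condVanishR at hvan hvan'
  simp only [h2, h4, if_false] at hvan hvan'
  by_cases h1 : ρ = 1
  · subst h1
    simp only [condVanish, if_true] at hvan hvan'
    have hcap := le_rank_srcFlattening (K := K) T M1 (hcap1 rfl)
    have hcap' : 3 * r ≤
        (srcFlattening 4 1 ((mat4 b M1).map (Int.cast : ℤ → K)) fun i j l => (T i j l : K)).rank + 1 := by
      omega
    have hy := vecMul_srcFlattening_eq_zero (K := K) T M1 v hvan
    have hy' := vecMul_srcFlattening_eq_zero (K := K) T M1 v' hvan'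
    have hform : ∀ (w : List (ℕ × ℤ)) (s₀ : ℕ),
        (∑ j : Fin b, ∑ l : Fin c, (lamEntryR b c M1 M3 (1, w, s₀) j l : K) * Z j l) =
          ∑ rr : PSub 4 2 × Fin c, intCertRow (F := K) (rowDec4 c) w rr *
            ∑ j, (∑ x, (wedgeInc rr.1.1 (singOf4 (finCode 4 s₀)).1 x : K) *
              ((mat4 b M1).map (Int.cast : ℤ → K)) x j) * Z j rr.2 := by
      intro w s₀
      simp only [lamEntryR, show (1 : ℕ) ≠ 2 by decide, show (1 : ℕ) ≠ 4 by decide, if_false,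
        lamEntry, if_true]
      rw [sum_lamEntry_one]
    rw [hform v s, hform v' s', hform v s', hform v' s]
    exact srcFlattening_minor 4 1 ((mat4 b M1).map (Int.cast : ℤ → K)) tK Z hle
      (by rw [h3]; simpa using hcap') _ _ hy hy' _ _
  · simp only [condVanish, h1, if_false] at hvan hvan'
    have hcap := le_rank_srcFlattening (K := K) (fun i l j => T i j l) M3 (hcap3 h1 h2 h4)
    have hcap' : 3 * r ≤ (srcFlattening 4 1 ((mat4 c M3).map (Int.cast : ℤ → K))
        fun i j l => (T i l j : K)).rank + 1 := by
      omega
    have hy := vecMul_srcFlattening_eq_zero (K := K) (fun i l j => T i j l) M3 v hvan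
    have hy' := vecMul_srcFlattening_eq_zero (K := K) (fun i l j => T i j l) M3 v' hvan'
    have hform : ∀ (w : List (ℕ × ℤ)) (s₀ : ℕ),
        (∑ j : Fin b, ∑ l : Fin c, (lamEntryR b c M1 M3 (ρ, w, s₀) j l : K) * Z j l) =
          ∑ rr : PSub 4 2 × Fin b, intCertRow (F := K) (rowDec4 b) w rr *
            ∑ j, (∑ x, (wedgeInc rr.1.1 (singOf4 (finCode 4 s₀)).1 x : K) *
              ((mat4 c M3).map (Int.cast : ℤ → K)) x j) * (fun l j => Z j l) j rr.2 := by
      intro w s₀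
      simp only [lamEntryR, h2, h4, if_false, lamEntry, h1]
      rw [Finset.sum_comm, sum_lamEntry_one]
    rw [hform v s, hform v' s', hform v s', hform v' s]
    exact srcFlattening_minor 4 1 ((mat4 c M3).map (Int.cast : ℤ → K)) (fun i l j => tK i j l)
      (fun l j => Z j l) hext (by rw [h3]; simpa using hcap') _ _ hy hy' _ _

/-! ### C.2 Linear and quadratic forms on codes -/

/-- `Z` read on codes `k = j c + l`. [folklore] -/
def zOf {b c : ℕ} (Z : Fin b → Fin c → K) (k : Fin (b * c)) : K := Z k.divNat k.modNat

/-- The linear form with integer coefficient row `u` on codes. [folklore] -/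
def linK {N : ℕ} (u : ℕ → ℤ) (z : Fin N → K) : K := ∑ k : Fin N, (u k : K) * z k

/-- The quadratic form with integer upper-triangular coefficients `coef k₁ k₂` (`k₁ ≤ k₂`). [folklore] -/
def evalQ {N : ℕ} (coef : ℕ → ℕ → ℤ) (z : Fin N → K) : K :=
  ∑ k1 : Fin N, ∑ k2 : Fin N, (if (k1 : ℕ) ≤ k2 then (coef k1 k2 : K) else 0) * (z k1 * z k2)

/-- Double sums over `Fin b × Fin c` are sums over codes. [folklore] -/
theorem sum_pair_eq_sum_code {b c : ℕ} (g : Fin b → Fin c → K) :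
    ∑ j, ∑ l, g j l = ∑ k : Fin (b * c), g k.divNat k.modNat := by
  rw [← Fintype.sum_prod_type']
  exact (Fintype.sum_equiv finProdFinEquiv.symm (fun k : Fin (b * c) => g k.divNat k.modNat)
    (fun p : Fin b × Fin c => g p.1 p.2) fun k => by simp).symm

/-- **Product of two linear forms** = the quadratic form with coefficients `prodCoef`. [folklore] -/
theorem linK_mul_linK {N : ℕ} (u v : ℕ → ℤ) (z : Fin N → K) :
    linK u z * linK v z = evalQ (prodCoef u v) z := by
  classical
  unfold linK evalQ
  rw [Finset.sum_mul_sum]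
  have hL : ∀ k1 k2 : Fin N, (u k1 : K) * z k1 * ((v k2 : K) * z k2) =
      (if (k1 : ℕ) < k2 then (u k1 : K) * v k2 * (z k1 * z k2) else 0) +
      (if (k2 : ℕ) < k1 then (u k1 : K) * v k2 * (z k1 * z k2) else 0) +
      (if k1 = k2 then (u k1 : K) * v k2 * (z k1 * z k2) else 0) := by
    intro k1 k2
    rcases lt_trichotomy (k1 : ℕ) k2 with h | h | h
    · have hne : k1 ≠ k2 := fun e => absurd (e ▸ h) (lt_irrefl _)
      simp only [h, if_true, not_lt.2 h.le, if_false, hne, add_zero]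
      ring
    · have heq : k1 = k2 := Fin.ext h
      subst heq
      simp only [lt_irrefl, if_false, if_true, zero_add]
      ring
    · have hne : k1 ≠ k2 := fun e => absurd (e ▸ h) (lt_irrefl _)
      simp only [h, if_true, not_lt.2 h.le, if_false, hne, zero_add, add_zero]
      ring
  have hR : ∀ k1 k2 : Fin N,
      (if (k1 : ℕ) ≤ k2 then (prodCoef u v k1 k2 : K) else 0) * (z k1 * z k2) =
      (if (k1 : ℕ) < k2 then (u k1 : K) * v k2 * (z k1 * z k2) else 0) +
      (if (k1 : ℕ) < k2 then (u k2 : K) * v k1 * (z k1 * z k2) else 0) +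
      (if k1 = k2 then (u k1 : K) * v k2 * (z k1 * z k2) else 0) := by
    intro k1 k2
    unfold prodCoef
    rcases lt_trichotomy (k1 : ℕ) k2 with h | h | h
    · have hne : k1 ≠ k2 := fun e => absurd (e ▸ h) (lt_irrefl _)
      have hne' : (k1 : ℕ) ≠ k2 := ne_of_lt h
      simp only [h.le, if_true, hne', if_false, h, hne, add_zero]
      push_cast
      ring
    · have heq : k1 = k2 := Fin.ext h
      subst heq
      simp only [le_refl, if_true, lt_irrefl, if_false, zero_add]
      push_cast
      ring
    · have hne : k1 ≠ k2 := fun e => absurd (e ▸ h) (lt_irrefl _)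
      simp only [not_le.2 h, if_false, not_lt.2 h.le, hne, add_zero, zero_mul]
  simp_rw [hL, hR, Finset.sum_add_distrib]
  congr 2
  rw [Finset.sum_comm]
  refine Finset.sum_congr rfl fun k1 _ => Finset.sum_congr rfl fun k2 _ => ?_
  split_ifs <;> ring

/-- Quadratic forms with coefficients agreeing on `k₁ ≤ k₂ < N` are equal. [folklore] -/
theorem evalQ_congr {N : ℕ} {f g : ℕ → ℕ → ℤ} (z : Fin N → K)
    (h : ∀ k1 k2 : ℕ, k1 < N → k2 < N → k1 ≤ k2 → f k1 k2 = g k1 k2) : evalQ f z = evalQ g z := by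
  unfold evalQ
  refine Finset.sum_congr rfl fun k1 _ => Finset.sum_congr rfl fun k2 _ => ?_
  split_ifs with hk
  · rw [h k1 k2 k1.isLt k2.isLt hk]
  · rfl

/-- Scaling. [folklore] -/
theorem evalQ_smul {N : ℕ} (D : ℤ) (f : ℕ → ℕ → ℤ) (z : Fin N → K) :
    evalQ (fun k1 k2 => D * f k1 k2) z = (D : K) * evalQ f z := by
  unfold evalQ
  rw [Finset.mul_sum]
  refine Finset.sum_congr rfl fun k1 _ => ?_
  rw [Finset.mul_sum]
  refine Finset.sum_congr rfl fun k2 _ => ?_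
  split_ifs
  · push_cast; ring
  · simp

/-- Difference. [folklore] -/
theorem evalQ_sub {N : ℕ} (f g : ℕ → ℕ → ℤ) (z : Fin N → K) :
    evalQ (fun k1 k2 => f k1 k2 - g k1 k2) z = evalQ f z - evalQ g z := by
  unfold evalQ
  rw [← Finset.sum_sub_distrib]
  refine Finset.sum_congr rfl fun k1 _ => ?_
  rw [← Finset.sum_sub_distrib]
  refine Finset.sum_congr rfl fun k2 _ => ?_
  split_ifs
  · push_cast; ring
  · simp

/-- Integer combinations (sparse list `(m, C)`). [folklore] -/
theorem evalQ_comb {N : ℕ} (l : List (ℕ × ℤ)) (G : ℕ → ℕ → ℕ → ℤ) (z : Fin N → K) :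
    evalQ (fun k1 k2 => (l.map fun mc => mc.2 * G mc.1 k1 k2).sum) z =
      (l.map fun mc => (mc.2 : K) * evalQ (G mc.1) z).sum := by
  induction l with
  | nil => simp [evalQ]
  | cons mc l ih =>
    simp only [List.map_cons, List.sum_cons]
    rw [← ih, ← evalQ_smul]
    unfold evalQ
    rw [← Finset.sum_add_distrib]
    refine Finset.sum_congr rfl fun k1 _ => ?_
    rw [← Finset.sum_add_distrib]
    refine Finset.sum_congr rfl fun k2 _ => ?_
    split_ifs
    · push_cast; ring
    · simp

/-- The minor's quadratic form is the minor of the forms. [folklore] -/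
theorem evalQ_minorCoef {N : ℕ} (ltab : List (List ℤ)) (m : QMinor) (z : Fin N → K) :
    evalQ (minorCoef ltab m) z =
      linK (mget ltab (m.1 * 6 + m.2.2.1)) z * linK (mget ltab (m.2.1 * 6 + m.2.2.2)) z -
        linK (mget ltab (m.1 * 6 + m.2.2.2)) z * linK (mget ltab (m.2.1 * 6 + m.2.2.1)) z := by
  rw [linK_mul_linK, linK_mul_linK, ← evalQ_sub]
  rfl

/-- The tabulated form `6α + s` IS `λ_{(ρ_α, v_α, s)}` as a linear form on `K^{b×c}`. [folklore] -/
theorem linK_ltab {b c : ℕ} [NeZero b] [NeZero c] {M1 M3 : List (List ℤ)} {kv : List KVec}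
    {ltab : List (List ℤ)} (hlt : ltabOk b c M1 M3 kv ltab = true) {α s : ℕ} (hα : α < kv.length)
    (hs : s < 6) (Z : Fin b → Fin c → K) :
    linK (mget ltab (α * 6 + s)) (zOf Z) =
      ∑ j : Fin b, ∑ l : Fin c, (lamEntryR b c M1 M3 (qcond kv α s) j l : K) * Z j l := by
  rw [sum_pair_eq_sum_code]
  unfold linK zOf
  refine Finset.sum_congr rfl fun k _ => ?_
  unfold ltabOk at hlt
  rw [List.all_eq_true] at hlt
  have h1 := hlt α (List.mem_range.2 hα)
  rw [List.all_eq_true] at h1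
  have h2 := h1 s (List.mem_range.2 hs)
  rw [List.all_eq_true] at h2
  have h3 := h2 k (List.mem_range.2 k.isLt)
  rw [beq_iff_eq] at h3
  rw [h3]
  rfl

/-! ### C.3 The functionals as a linear map -/

/-- The linear map `ℓ : K^{b×c} → K^{bc}` of the functional table. [folklore] -/
noncomputable def lfunMap (K : Type u) [Field K] (b c : ℕ) (Lfun : List (List ℤ)) :
    (Fin b → Fin c → K) →ₗ[K] (Fin (b * c) → K) :=
  ((lfunMat b c Lfun).map (Int.cast : ℤ → K)).mulVecLin ∘ₗ
    (LinearEquiv.curry K K (Fin b) (Fin c)).symm.toLinearMap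

/-- Entries of `ℓ Z`. [folklore] -/
theorem lfunMap_apply (b c : ℕ) (Lfun : List (List ℤ)) (Z : Fin b → Fin c → K) (k : Fin (b * c)) :
    lfunMap K b c Lfun Z k = ∑ j : Fin b, ∑ l : Fin c, (mget Lfun k (j * c + l) : K) * Z j l := by
  simp only [lfunMap, LinearMap.coe_comp, Function.comp_apply, Matrix.mulVecLin_apply,
    Matrix.mulVec, dotProduct, Fintype.sum_prod_type, Matrix.map_apply, lfunMat, Matrix.of_apply]
  rfl

/-- `ℓ_k(Z)` is the code-level linear form of row `k`. [folklore] -/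
theorem lfunMap_apply_eq_linK (b c : ℕ) (Lfun : List (List ℤ)) (Z : Fin b → Fin c → K)
    (k : Fin (b * c)) : lfunMap K b c Lfun Z k = linK (mget Lfun k) (zOf Z) := by
  rw [lfunMap_apply, sum_pair_eq_sum_code]
  unfold linK zOf
  refine Finset.sum_congr rfl fun q _ => ?_
  have e : ((q.divNat : Fin b) : ℕ) * c + ((q.modNat : Fin c) : ℕ) = q := Nat.div_add_mod' q c
  rw [e]

/-- `rank ℓ ≥ n` from a unit-pivot row certificate of `lfunCode`. [folklore] -/
theorem le_finrank_range_lfunMap {b c n : ℕ} [NeZero b] [NeZero c] {Lfun : List (List ℤ)}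
    {rowsL : List (List (ℕ × ℤ))} {pivL : List ℕ}
    (hL : intTriCheckUnit n (lfunCode b c Lfun) rowsL pivL = true) :
    n ≤ Module.finrank K (LinearMap.range (lfunMap K b c Lfun)) := by
  classical
  have htop : LinearMap.range (LinearEquiv.curry K K (Fin b) (Fin c)).symm.toLinearMap = ⊤ :=
    LinearEquiv.range _
  rw [lfunMap, LinearMap.range_comp_of_range_eq_top _ htop]
  have hneq : NeZero (b * c) := ⟨Nat.mul_ne_zero (NeZero.ne b) (NeZero.ne c)⟩
  exact le_rank_of_intTriCheckUnit (F := K) (lfunMat b c Lfun) (finCode (b * c)) (slabDec b c) hL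

/-- The functionals kill the slices (from `funKills`). [folklore] -/
theorem sliceSpan_le_ker_lfunMap {a b c : ℕ} [NeZero a] [NeZero b] [NeZero c]
    (T : Fin a → Fin b → Fin c → ℤ) {Lfun : List (List ℤ)} (hkill : funKills a b c T Lfun = true) :
    sliceSpan (fun i j l => (T i j l : K)) ≤ LinearMap.ker (lfunMap K b c Lfun) := by
  classical
  rw [sliceSpan, Submodule.span_le]
  rintro _ ⟨i, rfl⟩
  rw [SetLike.mem_coe, LinearMap.mem_ker]
  beta_reduce
  funext k
  rw [Pi.zero_apply, lfunMap_apply]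
  unfold funKills at hkill
  rw [List.all_eq_true] at hkill
  have h1 := hkill k (List.mem_range.2 k.isLt)
  rw [List.all_eq_true] at h1
  have h2 := h1 i (List.mem_range.2 i.isLt)
  have hfa : finCode a (i : ℕ) = i := Fin.ext (Nat.mod_eq_of_lt i.isLt)
  have hfb : ∀ j : Fin b, finCode b (j : ℕ) = j := fun j => Fin.ext (Nat.mod_eq_of_lt j.isLt)
  have hfc : ∀ l : Fin c, finCode c (l : ℕ) = l := fun l => Fin.ext (Nat.mod_eq_of_lt l.isLt)
  simp only [hfa] at h2
  rw [beq_iff_eq, lsum_eq] at h2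
  simp only [lsum_eq] at h2
  have h3 := congrArg (Int.cast : ℤ → K) h2
  simp only [Int.cast_sum, Int.cast_mul, Int.cast_zero, hfb, hfc] at h3
  exact h3

/-! ### C.4 Soundness -/

/-- **Soundness of the quadratic (slack-one) sieve certificate**: `checkQ` and `D ≠ 0` in `K`,
`a < r ≤ bR(T)` imply `r < bR(T)`. [cite: JagiellaJelisiejew2026Unrestrictions, Thm. 2.2] [cite: LandsbergOttaviani2015, Thm 2.1] -/
theorem lt_algBorderRank_of_checkQ (K : Type u) [Field K] {a b c r : ℕ} [NeZero a] [NeZero b]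
    [NeZero c] (T : Fin a → Fin b → Fin c → ℤ) {M1 M3 : List (List ℤ)} {kv : List KVec}
    {ltab : List (List ℤ)} {qsel : List QMinor} {Lfun : List (List ℤ)} {D : ℤ}
    {sq : List (List (ℕ × ℤ))} {rows1 rows2 rows3 rows4 rowsL rowsS : List (List (ℕ × ℤ))}
    {piv1 piv2 piv3 piv4 pivL pivS : List ℕ}
    (h : checkQ a b c r T M1 M3 kv ltab qsel Lfun D sq rows1 piv1 rows2 piv2 rows3 piv3 rows4 piv4
      rowsL pivL rowsS pivS = true)
    (hD : (D : K) ≠ 0) (har : a < r) (hr : r ≤ algBorderRank (fun i j l => (T i j l : K))) :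
    r < algBorderRank (fun i j l => (T i j l : K)) := by
  classical
  unfold checkQ at h
  simp only [Bool.and_eq_true] at h
  obtain ⟨⟨⟨⟨⟨⟨⟨hkv, hcaps⟩, hlt⟩, hqs⟩, hkill⟩, hL⟩, hS⟩, hsq⟩ := h
  set tK : Fin a → Fin b → Fin c → K := fun i j l => (T i j l : K) with htK
  refine lt_algBorderRank_of_card_lt_of_forall_extendSlice tK (by simpa using har) hr fun Z hZ => ?_
  by_contra hle'
  have hle : algBorderRank (extendSlice tK Z) ≤ r := le_of_not_gt hle'
  apply hZ
  -- (0) unpack the caps and the kernel-vector certificates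
  unfold capsQ at hcaps
  simp only [Bool.and_eq_true] at hcaps
  obtain ⟨⟨⟨hc1, hc2⟩, hc3⟩, hc4⟩ := hcaps
  rw [List.all_eq_true] at hkv
  have hmemkv : ∀ α, α < kv.length → kvGet kv α ∈ kv := fun α hα => by
    unfold kvGet
    rw [List.getD_eq_getElem?_getD, List.getElem?_eq_getElem hα, Option.getD_some]
    exact List.getElem_mem hα
  -- (1) every selected minor vanishes at `Z`
  have hminor : ∀ m, m < qsel.length →
      evalQ (minorCoef ltab (qsel.getD m (0, 0, 0, 0))) (zOf Z) = 0 := by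
    intro m hm
    set mn := qsel.getD m (0, 0, 0, 0) with hmn
    have hmem : mn ∈ qsel := by
      rw [hmn, List.getD_eq_getElem?_getD, List.getElem?_eq_getElem hm, Option.getD_some]
      exact List.getElem_mem hm
    unfold qselOk at hqs
    rw [List.all_eq_true] at hqs
    have hq := hqs mn hmem
    simp only [Bool.and_eq_true, decide_eq_true_eq, beq_iff_eq] at hq
    obtain ⟨⟨⟨⟨hα, hα'⟩, hs⟩, hs'⟩, hrole⟩ := hq
    rw [evalQ_minorCoef, linK_ltab hlt hα hs, linK_ltab hlt hα' hs', linK_ltab hlt hα hs',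
      linK_ltab hlt hα' hs]
    unfold qcond
    rw [← hrole]
    have hv := hkv _ (hmemkv _ hα)
    have hv' := hkv _ (hmemkv _ hα')
    rw [← hrole] at hv'
    refine qminor_eq_zero (r := r) (rows1 := rows1) (rows2 := rows2) (rows3 := rows3)
      (rows4 := rows4) (piv1 := piv1) (piv2 := piv2) (piv3 := piv3) (piv4 := piv4) T
      (kvGet kv mn.1).1 (kvGet kv mn.1).2 (kvGet kv mn.2.1).2 mn.2.2.1 mn.2.2.2 hv hv'
      ?_ ?_ ?_ ?_ Z hle
    · intro h1
      have hany : (kv.any fun rv => rv.1 == 1) = true :=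
        List.any_eq_true.2 ⟨_, hmemkv _ hα, by simp [h1]⟩
      simpa [hany] using hc1
    · intro h2
      have hany : (kv.any fun rv => rv.1 == 2) = true :=
        List.any_eq_true.2 ⟨_, hmemkv _ hα, by simp [h2]⟩
      simpa [hany] using hc2
    · intro h1 h2 h4
      have hany : (kv.any fun rv => !(rv.1 == 1) && !(rv.1 == 2) && !(rv.1 == 4)) = true :=
        List.any_eq_true.2 ⟨_, hmemkv _ hα, by simp [h1, h2, h4]⟩
      simpa [hany] using hc3
    · intro h4
      have hany : (kv.any fun rv => rv.1 == 4) = true :=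
        List.any_eq_true.2 ⟨_, hmemkv _ hα, by simp [h4]⟩
      simpa [hany] using hc4
  -- (2) every functional vanishes at `Z`: `D ℓ_i(Z)² = ∑ C · minor(Z) = 0`
  have hfun : ∀ i : Fin (b * c), linK (mget Lfun i) (zOf Z) = 0 := by
    intro i
    unfold sqOk at hsq
    rw [List.all_eq_true] at hsq
    have hi := hsq i (List.mem_range.2 i.isLt)
    rw [Bool.and_eq_true, List.all_eq_true, List.all_eq_true] at hi
    obtain ⟨hrange, hcoef⟩ := hi
    have hsqr : (D : K) * (linK (mget Lfun i) (zOf Z) * linK (mget Lfun i) (zOf Z)) = 0 := by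
      rw [linK_mul_linK, ← evalQ_smul]
      rw [evalQ_congr (zOf Z) (g := fun k1 k2 => ((sq.getD i []).map fun mc =>
          mc.2 * minorCoef ltab (qsel.getD mc.1 (0, 0, 0, 0)) k1 k2).sum) ?_]
      · rw [evalQ_comb (sq.getD i []) (fun m => minorCoef ltab (qsel.getD m (0, 0, 0, 0))) (zOf Z)]
        apply List.sum_eq_zero
        intro x hx
        rw [List.mem_map] at hx
        obtain ⟨mc, hmc, rfl⟩ := hx
        have hm : mc.1 < qsel.length := by
          have := hrange mc hmc
          simpa using this
        rw [hminor mc.1 hm, mul_zero]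
      · intro k1 k2 hk1 hk2 hk
        have h1 := hcoef k1 (List.mem_range.2 hk1)
        rw [List.all_eq_true] at h1
        have h2 := h1 k2 (List.mem_range.2 hk2)
        simp only [hk, decide_true, Bool.not_true, Bool.false_or, beq_iff_eq] at h2
        exact h2
    rcases mul_eq_zero.1 hsqr with hD0 | hsq0
    · exact absurd hD0 hD
    · exact mul_self_eq_zero.1 hsq0
  -- (3) `ℓ Z = 0`
  have hΨZ : lfunMap K b c Lfun Z = 0 := by
    funext k
    rw [Pi.zero_apply, lfunMap_apply_eq_linK]
    exact hfun k
  -- (4) `dim V = a`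
  have hVdim : a ≤ Module.finrank K (sliceSpan tK) := by
    have hrk := le_rank_of_intTriCheckUnit (F := K) (slab₁ T) (finCode a) (slabDec b c) hS
    have em : (slab₁ T).map (Int.cast : ℤ → K) = slab₁ tK := rfl
    rw [em] at hrk
    have hli := linearIndependent_of_card_le_rank_slab₁ tK (by simpa using hrk)
    rw [sliceSpan, finrank_span_eq_card hli, Fintype.card_fin]
  -- (5) dimension count
  have hdim : Module.finrank K (Fin b → Fin c → K) ≤ (b * c - a) + a := by
    rw [finrank_slices]; omega
  exact mem_of_le_ker_of_finrank _ (sliceSpan tK) (sliceSpan_le_ker_lfunMap T hkill) hdim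
    (le_finrank_range_lfunMap hL) hVdim hΨZ

/-- Transport: a certificate for the rotated tensor `(j, l, i) ↦ T i j l` (extended factor = the
SECOND factor of `T`) bounds `bR(T)`. [cite: Blaser2013, §5.1 (permutation of tensors)] -/
theorem lt_algBorderRank_of_checkQ_rotate₁ (K : Type u) [Field K] {a b c r : ℕ} [NeZero a]
    [NeZero b] [NeZero c] (T : Fin a → Fin b → Fin c → ℤ) {M1 M3 : List (List ℤ)} {kv : List KVec}
    {ltab : List (List ℤ)} {qsel : List QMinor} {Lfun : List (List ℤ)} {D : ℤ}
    {sq : List (List (ℕ × ℤ))} {rows1 rows2 rows3 rows4 rowsL rowsS : List (List (ℕ × ℤ))}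
    {piv1 piv2 piv3 piv4 pivL pivS : List ℕ}
    (h : checkQ b c a r (fun j l i => T i j l) M1 M3 kv ltab qsel Lfun D sq rows1 piv1 rows2 piv2
      rows3 piv3 rows4 piv4 rowsL pivL rowsS pivS = true)
    (hD : (D : K) ≠ 0) (hbr : b < r) (hr : r ≤ algBorderRank (fun i j l => (T i j l : K))) :
    r < algBorderRank (fun i j l => (T i j l : K)) := by
  have hr' : r ≤ algBorderRank (fun j l i => (T i j l : K)) := by
    rw [← algBorderRank_rotate (fun i j l => (T i j l : K))] at hr
    exact hr
  have key := lt_algBorderRank_of_checkQ K (fun j l i => T i j l) h hD hbr hr'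
  rw [← algBorderRank_rotate (fun i j l => (T i j l : K))]
  exact key

/-- Transport: a certificate for the rotated tensor `(l, i, j) ↦ T i j l` (extended factor = the
THIRD factor of `T`) bounds `bR(T)`. [cite: Blaser2013, §5.1 (permutation of tensors)] -/
theorem lt_algBorderRank_of_checkQ_rotate₂ (K : Type u) [Field K] {a b c r : ℕ} [NeZero a]
    [NeZero b] [NeZero c] (T : Fin a → Fin b → Fin c → ℤ) {M1 M3 : List (List ℤ)} {kv : List KVec}
    {ltab : List (List ℤ)} {qsel : List QMinor} {Lfun : List (List ℤ)} {D : ℤ}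
    {sq : List (List (ℕ × ℤ))} {rows1 rows2 rows3 rows4 rowsL rowsS : List (List (ℕ × ℤ))}
    {piv1 piv2 piv3 piv4 pivL pivS : List ℕ}
    (h : checkQ c a b r (fun l i j => T i j l) M1 M3 kv ltab qsel Lfun D sq rows1 piv1 rows2 piv2
      rows3 piv3 rows4 piv4 rowsL pivL rowsS pivS = true)
    (hD : (D : K) ≠ 0) (hcr : c < r) (hr : r ≤ algBorderRank (fun i j l => (T i j l : K))) :
    r < algBorderRank (fun i j l => (T i j l : K)) := by
  have hr' : r ≤ algBorderRank (fun l i j => (T i j l : K)) := by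
    rw [← algBorderRank_rotate (fun i j l => (T i j l : K)), ← algBorderRank_rotate] at hr
    exact hr
  have key := lt_algBorderRank_of_checkQ K (fun l i j => T i j l) h hD hcr hr'
  rw [← algBorderRank_rotate (fun i j l => (T i j l : K)), ← algBorderRank_rotate]
  exact key

end Sound

end SieveCert

end Literature.Computability.AlgebraicComplexity
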